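import Summits.KontsevichZagierPeriods.KontsevichZagierPeriods.Theorems.FiveTermTransfer.Negative.SignDictionary
import Summits.KontsevichZagierPeriods.KontsevichZagierPeriods.Theorems.HyperbolicBlochFiveTermTransferStubCircuitCore
import Summits.KontsevichZagierPeriods.KontsevichZagierPeriods.Theorems.HyperbolicBlochFiveTermTransferStubDetDictionary
import Literature.NumberTheory.Transcendental.KZIdealTetrahedron
import Literature.MeasureTheory.Lebesgue.PolynomialZeroSet

/-!
# `FiveTermTransfer` (stmt-KontsevichZagierPeriods-3469) — line `valuation-kernel-sweep`,
stub `stub_fiveTermIndicator` (the lead-held stub)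

The pointwise heart of the five-term relation: on one copy of the upper half space carrying the
configuration `{∞, 0, 1, x, y}` (`x, y ∉ {0, 1}`, `x ≠ y`), the signed indicator functions of the
five ideal sub-solids — the prisms over the triangles `(0,1,x)`, `(0,1,y)`, `(0,x,y)`, `(1,y,x)` and
the finite ideal tetrahedron `(0,1,x,y)`, with the orientation signs `sg` of the crux's class map
`B` — sum to zero almost everywhere.

Proof (no case analysis on the configuration type): lift `p ↦ Q = (|p|², p₀, p₁, 1) ∈ ℝ⁴` and the
ideal points to `ℓ'(∞) = (1,0,0,0)`, `ℓ'(w) = (|w|², Re w, Im w, 1)`. The route's forms `L`, `S` are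
then `4 × 4` determinants, each solid is "all four Cramer coordinates of `Q` in the basis omitting
one lifted point are positive" (`stub_detDictionary`), the coefficients are `(−1)ʲ sign D j`
(`Negative/SignDictionary.lean`), and the identity is the circuit lemma for five vectors of `ℝ⁴`
(`stub_circuitCore`: along the line of representations the positive-`λ` cone hit is the unique
strict argmax, the negative-`λ` hit the unique strict argmin). Genericity fails only on the walls
`E p j a = 0`, zero sets of non-trivial sphere polynomials `α|p|² + βp₀ + γp₁ + δ`
(`volume_quadric_eq_zero`, via `MvPolynomial.volume_zeroSet_eq_zero`), and when no `λ_j` of either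
sign exists all five minors vanish (`Im x = Im y = 0`).
-/

noncomputable section

open MeasureTheory Set Complex
open scoped ComplexConjugate

namespace Summit.KontsevichZagierPeriods.HyperbolicBloch.FiveTerm

open Literature.NumberTheory.Transcendental
open Literature.NumberTheory.Transcendental.KZ
open Summit.KontsevichZagierPeriods.HyperbolicBloch.FiveTermTransferNegative

/-! ## Tools: multilinearity, null quadrics, signs -/

/-- Multilinearity of the determinant in one row, `Fin 4` spelled out. [folklore] -/
theorem det_updateRow_fin_four (M : Matrix (Fin 4) (Fin 4) ℝ) (a : Fin 4) (Q : Fin 4 → ℝ) :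
    (M.updateRow a Q).det = Q 0 * (M.updateRow a ![1, 0, 0, 0]).det +
      Q 1 * (M.updateRow a ![0, 1, 0, 0]).det + Q 2 * (M.updateRow a ![0, 0, 1, 0]).det +
      Q 3 * (M.updateRow a ![0, 0, 0, 1]).det := by
  have hQ : Q = Q 0 • (![1, 0, 0, 0] : Fin 4 → ℝ) + Q 1 • (![0, 1, 0, 0] : Fin 4 → ℝ) +
      Q 2 • (![0, 0, 1, 0] : Fin 4 → ℝ) + Q 3 • (![0, 0, 0, 1] : Fin 4 → ℝ) := by
    ext i
    fin_cases i <;> simp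
  conv_lhs => rw [hQ]
  simp only [Matrix.det_updateRow_add, Matrix.det_updateRow_smul]

/-- The zero set of a non-trivial "sphere polynomial" `α |p|² + β p₀ + γ p₁ + δ` on `ℝ³` is
Lebesgue-null. [folklore] -/
theorem volume_quadric_eq_zero (α β γ δ : ℝ) (h : ¬ (α = 0 ∧ β = 0 ∧ γ = 0 ∧ δ = 0)) :
    volume {p : Fin 3 → ℝ | α * (p 0 ^ 2 + p 1 ^ 2 + p 2 ^ 2) + β * p 0 + γ * p 1 + δ = 0} = 0 := by
  classical
  set Pq : MvPolynomial (Fin 3) ℝ := MvPolynomial.C α * (MvPolynomial.X 0 ^ 2 + MvPolynomial.X 1 ^ 2 +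
      MvPolynomial.X 2 ^ 2) + MvPolynomial.C β * MvPolynomial.X 0 + MvPolynomial.C γ * MvPolynomial.X 1 +
      MvPolynomial.C δ with hPq
  have heval : ∀ p : Fin 3 → ℝ, MvPolynomial.eval p Pq =
      α * (p 0 ^ 2 + p 1 ^ 2 + p 2 ^ 2) + β * p 0 + γ * p 1 + δ := by
    intro p
    simp [hPq]
  have hset : {p : Fin 3 → ℝ | α * (p 0 ^ 2 + p 1 ^ 2 + p 2 ^ 2) + β * p 0 + γ * p 1 + δ = 0} =
      {p | MvPolynomial.eval p Pq = 0} := by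
    ext p
    rw [mem_setOf_eq, mem_setOf_eq, heval]
  rw [hset]
  refine MvPolynomial.volume_zeroSet_eq_zero 3 Pq ?_
  intro h0
  have e : ∀ p : Fin 3 → ℝ, α * (p 0 ^ 2 + p 1 ^ 2 + p 2 ^ 2) + β * p 0 + γ * p 1 + δ = 0 := by
    intro p
    rw [← heval, h0, map_zero]
  have e0 := e ![0, 0, 0]
  have e1 := e ![1, 0, 0]
  have e2 := e ![-1, 0, 0]
  have e3 := e ![0, 1, 0]
  simp at e0 e1 e2 e3
  apply h
  refine ⟨by linarith, by linarith, by linarith, by linarith⟩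

/-- `Real.sign (t * c) = Real.sign t` for `c > 0`. [folklore] -/
theorem sign_mul_pos {t c : ℝ} (hc : 0 < c) : Real.sign (t * c) = Real.sign t := by
  rcases lt_trichotomy t 0 with h | h | h
  · rw [Real.sign_of_neg h, Real.sign_of_neg (mul_neg_of_neg_of_pos h hc)]
  · rw [h, zero_mul]
  · rw [Real.sign_of_pos h, Real.sign_of_pos (mul_pos h hc)]

/-- `Real.sign (-t) = -Real.sign t`. [folklore] -/
theorem sign_neg' (t : ℝ) : Real.sign (-t) = -Real.sign t := by
  rcases lt_trichotomy t 0 with h | h | h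
  · rw [Real.sign_of_neg h, Real.sign_of_pos (neg_pos.mpr h), neg_neg]
  · rw [h, neg_zero, Real.sign_zero, neg_zero]
  · rw [Real.sign_of_pos h, Real.sign_of_neg (neg_neg_of_pos h)]

/-- The sign-of-imaginary-part function as `Real.sign`. [folklore] -/
theorem sg_cast_eq_sign (sg : ℂ → ℤ) (hsg : ∀ w, sg w = if 0 < w.im then 1 else if w.im < 0 then -1 else 0)
    (w : ℂ) : (sg w : ℝ) = Real.sign w.im := by
  rw [hsg]
  rcases lt_trichotomy w.im 0 with h | h | h
  · simp [h, not_lt.mpr h.le, Real.sign_of_neg h]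
  · simp [h, Real.sign_zero]
  · simp [h, Real.sign_of_pos h]

/-- **Signed indicator identity** (registered stub `stub_fiveTermIndicator`). On the configuration
`{∞, 0, 1, x, y}` the signed indicators of the five sub-solids (four prisms, one finite ideal
tetrahedron; coefficients the crux's signs `sg`) cancel almost everywhere: off the null walls
`E p j a = 0` (zero sets of non-trivial sphere polynomials, `volume_quadric_eq_zero`) this is the
circuit lemma `stub_circuitCore` read through the determinant dictionary `stub_detDictionary`,
the coefficients being `(−1)ʲ sign (D j)` by `Negative/SignDictionary.lean`; when
`Im x = Im y = 0` all five minors vanish. [folklore] -/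
theorem stub_fiveTermIndicator :
    ∀ (L : ℂ → ℂ → (Fin 3 → ℝ) → ℝ),
      (∀ u v p, L u v p = (v.re - u.re) * (p 1 - u.im) - (v.im - u.im) * (p 0 - u.re)) →
    ∀ (S : ℂ → ℂ → ℂ → (Fin 3 → ℝ) → ℝ),
      (∀ u v w p, S u v w p = (p 0 ^ 2 + p 1 ^ 2 + p 2 ^ 2) * (u.re * (v.im - w.im) - u.im * (v.re - w.re) + (v.re * w.im - v.im * w.re)) - p 0 * (Complex.normSq u * (v.im - w.im) - u.im * (Complex.normSq v - Complex.normSq w) + (Complex.normSq v * w.im - v.im * Complex.normSq w)) + p 1 * (Complex.normSq u * (v.re - w.re) - u.re * (Complex.normSq v - Complex.normSq w) + (Complex.normSq v * w.re - v.re * Complex.normSq w)) - (Complex.normSq u * (v.re * w.im - v.im * w.re) - u.re * (Complex.normSq v * w.im - v.im * Complex.normSq w) + u.im * (Complex.normSq v * w.re - v.re * Complex.normSq w))) →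
    ∀ (P : ℂ → ℂ → ℂ → Set (Fin 3 → ℝ)),
      (∀ u v w, P u v w = {p | 0 < p 2 ∧ 0 < L u v ![w.re, w.im, 0] * L u v p ∧ 0 < L u v ![w.re, w.im, 0] * L v w p ∧ 0 < L u v ![w.re, w.im, 0] * L w u p ∧ 0 < L u v ![w.re, w.im, 0] * S u v w p}) →
    ∀ (sg : ℂ → ℤ), (∀ w, sg w = if 0 < w.im then 1 else if w.im < 0 then -1 else 0) →
    ∀ (x y : ℂ), x ≠ 0 → x ≠ 1 → y ≠ 0 → y ≠ 1 → x ≠ y →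
      ∀ᵐ (p : Fin 3 → ℝ),
        (sg x : ℝ) * (P 0 1 x).indicator (fun _ => (1 : ℝ)) p
          - (sg y : ℝ) * (P 0 1 y).indicator (fun _ => (1 : ℝ)) p
          + (sg (y / x) : ℝ) * (P 0 x y).indicator (fun _ => (1 : ℝ)) p
          - (sg ((1 - x⁻¹) / (1 - y⁻¹)) : ℝ) *
              {q : Fin 3 → ℝ | 0 < q 2 ∧ 0 < S 1 x y q * S 1 x y ![0, 0, 0] ∧ 0 < S 0 x y q * S 0 x y ![1, 0, 0] ∧ 0 < S 0 1 y q * S 0 1 y ![x.re, x.im, 0] ∧ 0 < S 0 1 x q * S 0 1 x ![y.re, y.im, 0]}.indicator (fun _ => (1 : ℝ)) p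
          + (sg ((1 - x) / (1 - y)) : ℝ) * (P 1 y x).indicator (fun _ => (1 : ℝ)) p = 0 := by
  intro L hL S hS P hP sg hsg x y hx0 _hx1 hy0 hy1 _hxy
  classical
  -- the lifted configuration and its minors
  set v : Fin 5 → Fin 4 → ℝ := ![![1, 0, 0, 0], ![0, 0, 0, 1], ![1, 1, 0, 1],
    ![Complex.normSq x, x.re, x.im, 1], ![Complex.normSq y, y.re, y.im, 1]] with hv
  set D : Fin 5 → ℝ := fun j => (Matrix.of fun a b => v (j.succAbove a) b).det with hD
  set E : (Fin 3 → ℝ) → Fin 5 → Fin 4 → ℝ := fun p j a =>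
    ((Matrix.of fun a' b => v (j.succAbove a') b).updateRow a
      ![p 0 ^ 2 + p 1 ^ 2 + p 2 ^ 2, p 0, p 1, 1]).det with hE
  -- coefficients of `E p j a` as a sphere polynomial in `p`
  set C : Fin 5 → Fin 4 → Fin 4 → ℝ := fun j a b =>
    ((Matrix.of fun a' b' => v (j.succAbove a') b').updateRow a (Pi.single b 1)).det with hC
  have hEC : ∀ p j a, E p j a = C j a 0 * (p 0 ^ 2 + p 1 ^ 2 + p 2 ^ 2) + C j a 1 * p 0 +
      C j a 2 * p 1 + C j a 3 := by
    intro p j a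
    simp only [hE, hC]
    rw [det_updateRow_fin_four]
    have e0 : (Pi.single 0 1 : Fin 4 → ℝ) = ![1, 0, 0, 0] := by ext i; fin_cases i <;> simp
    have e1 : (Pi.single 1 1 : Fin 4 → ℝ) = ![0, 1, 0, 0] := by ext i; fin_cases i <;> simp
    have e2 : (Pi.single 2 1 : Fin 4 → ℝ) = ![0, 0, 1, 0] := by ext i; fin_cases i <;> simp
    have e3 : (Pi.single 3 1 : Fin 4 → ℝ) = ![0, 0, 0, 1] := by ext i; fin_cases i <;> simp
    rw [e0, e1, e2, e3]
    simp only [Matrix.cons_val_zero, Matrix.cons_val_one, Matrix.cons_val]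
    ring
  -- the coefficients do not all vanish when `D j ≠ 0`
  have hCne : ∀ j a, D j ≠ 0 → ¬ (C j a 0 = 0 ∧ C j a 1 = 0 ∧ C j a 2 = 0 ∧ C j a 3 = 0) := by
    intro j a hj hzero
    apply hj
    set M : Matrix (Fin 4) (Fin 4) ℝ := Matrix.of fun a' b' => v (j.succAbove a') b' with hM
    have key : (M.updateRow a (M a)).det = M a 0 * C j a 0 + M a 1 * C j a 1 + M a 2 * C j a 2 +
        M a 3 * C j a 3 := by
      simp only [hC]
      rw [det_updateRow_fin_four]
      have e0 : (Pi.single 0 1 : Fin 4 → ℝ) = ![1, 0, 0, 0] := by ext i; fin_cases i <;> simp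
      have e1 : (Pi.single 1 1 : Fin 4 → ℝ) = ![0, 1, 0, 0] := by ext i; fin_cases i <;> simp
      have e2 : (Pi.single 2 1 : Fin 4 → ℝ) = ![0, 0, 1, 0] := by ext i; fin_cases i <;> simp
      have e3 : (Pi.single 3 1 : Fin 4 → ℝ) = ![0, 0, 0, 1] := by ext i; fin_cases i <;> simp
      rw [e0, e1, e2, e3]
    rw [Matrix.updateRow_eq_self] at key
    simp only [hD]
    rw [key, hzero.1, hzero.2.1, hzero.2.2.1, hzero.2.2.2]
    ring
  -- the exceptional walls are null
  set N : Set (Fin 3 → ℝ) := ⋃ j : Fin 5, ⋃ a : Fin 4,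
    {p | D j ≠ 0 ∧ D (j.succAbove a) ≠ 0 ∧ E p j a = 0} with hN
  have hN0 : volume N = 0 := by
    refine measure_iUnion_null fun j => measure_iUnion_null fun a => ?_
    by_cases hj : D j ≠ 0 ∧ D (j.succAbove a) ≠ 0
    · have hsub : {p | D j ≠ 0 ∧ D (j.succAbove a) ≠ 0 ∧ E p j a = 0} ⊆
          {p : Fin 3 → ℝ | C j a 0 * (p 0 ^ 2 + p 1 ^ 2 + p 2 ^ 2) + C j a 1 * p 0 + C j a 2 * p 1 +
            C j a 3 = 0} := by
        intro p hp
        rw [mem_setOf_eq, ← hEC]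
        exact hp.2.2
      exact measure_mono_null hsub (volume_quadric_eq_zero _ _ _ _ (hCne j a hj.1))
    · have hempty : {p | D j ≠ 0 ∧ D (j.succAbove a) ≠ 0 ∧ E p j a = 0} = ∅ := by
        ext p
        simp only [mem_setOf_eq, mem_empty_iff_false, iff_false]
        exact fun hp => hj ⟨hp.1, hp.2.1⟩
      rw [hempty, measure_empty]
  -- pointwise identity off the walls
  have hae : ∀ᵐ p : Fin 3 → ℝ, p ∉ N := by
    rw [ae_iff]
    simpa using hN0
  filter_upwards [hae] with p hpN
  -- the trivial half-space `p 2 ≤ 0`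
  by_cases hp2 : 0 < p 2
  swap
  · have h1 : p ∉ P 0 1 x := fun h => hp2 (by rw [hP] at h; exact h.1)
    have h2 : p ∉ P 0 1 y := fun h => hp2 (by rw [hP] at h; exact h.1)
    have h3 : p ∉ P 0 x y := fun h => hp2 (by rw [hP] at h; exact h.1)
    have h5 : p ∉ P 1 y x := fun h => hp2 (by rw [hP] at h; exact h.1)
    have h4 : p ∉ {q : Fin 3 → ℝ | 0 < q 2 ∧ 0 < S 1 x y q * S 1 x y ![0, 0, 0] ∧
        0 < S 0 x y q * S 0 x y ![1, 0, 0] ∧ 0 < S 0 1 y q * S 0 1 y ![x.re, x.im, 0] ∧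
        0 < S 0 1 x q * S 0 1 x ![y.re, y.im, 0]} := fun h => hp2 h.1
    rw [indicator_of_notMem h1, indicator_of_notMem h2, indicator_of_notMem h3,
      indicator_of_notMem h4, indicator_of_notMem h5]
    ring
  -- the dictionary at `p`
  obtain ⟨⟨hD4, hD3, hD2, hD1, hD0⟩, h4, h3, h2, h1, h0⟩ :=
    stub_detDictionary L hL S hS P hP x y p v hv _ rfl D (fun _ => rfl) (E p) (fun _ _ => rfl)
  -- indicators as Boolean hits
  have I4 : (P 0 1 x).indicator (fun _ => (1 : ℝ)) p = if ∀ a, 0 < D 4 * E p 4 a then 1 else 0 := by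
    by_cases h : ∀ a, 0 < D 4 * E p 4 a
    · rw [if_pos h, indicator_of_mem (h4.mpr ⟨hp2, h⟩)]
    · rw [if_neg h, indicator_of_notMem (fun hm => h (h4.mp hm).2)]
  have I3 : (P 0 1 y).indicator (fun _ => (1 : ℝ)) p = if ∀ a, 0 < D 3 * E p 3 a then 1 else 0 := by
    by_cases h : ∀ a, 0 < D 3 * E p 3 a
    · rw [if_pos h, indicator_of_mem (h3.mpr ⟨hp2, h⟩)]
    · rw [if_neg h, indicator_of_notMem (fun hm => h (h3.mp hm).2)]
  have I2 : (P 0 x y).indicator (fun _ => (1 : ℝ)) p = if ∀ a, 0 < D 2 * E p 2 a then 1 else 0 := by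
    by_cases h : ∀ a, 0 < D 2 * E p 2 a
    · rw [if_pos h, indicator_of_mem (h2.mpr ⟨hp2, h⟩)]
    · rw [if_neg h, indicator_of_notMem (fun hm => h (h2.mp hm).2)]
  have I1 : (P 1 y x).indicator (fun _ => (1 : ℝ)) p = if ∀ a, 0 < D 1 * E p 1 a then 1 else 0 := by
    by_cases h : ∀ a, 0 < D 1 * E p 1 a
    · rw [if_pos h, indicator_of_mem (h1.mpr ⟨hp2, h⟩)]
    · rw [if_neg h, indicator_of_notMem (fun hm => h (h1.mp hm).2)]
  have I0 : {q : Fin 3 → ℝ | 0 < q 2 ∧ 0 < S 1 x y q * S 1 x y ![0, 0, 0] ∧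
        0 < S 0 x y q * S 0 x y ![1, 0, 0] ∧ 0 < S 0 1 y q * S 0 1 y ![x.re, x.im, 0] ∧
        0 < S 0 1 x q * S 0 1 x ![y.re, y.im, 0]}.indicator (fun _ => (1 : ℝ)) p =
      if ∀ a, 0 < D 0 * E p 0 a then 1 else 0 := by
    by_cases h : ∀ a, 0 < D 0 * E p 0 a
    · rw [if_pos h, indicator_of_mem (h0.mpr ⟨hp2, h⟩)]
    · rw [if_neg h, indicator_of_notMem (fun hm => h (h0.mp hm).2)]
  -- coefficients as signs of the minors
  have hNx : 0 < Complex.normSq x := Complex.normSq_pos.mpr hx0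
  have hNy : 0 < Complex.normSq (1 - y) := Complex.normSq_pos.mpr (sub_ne_zero.mpr (Ne.symm hy1))
  have c4 : (sg x : ℝ) = Real.sign (D 4) := by rw [sg_cast_eq_sign sg hsg, hD4]
  have c3 : (sg y : ℝ) = Real.sign (D 3) := by rw [sg_cast_eq_sign sg hsg, hD3]
  have c2 : (sg (y / x) : ℝ) = Real.sign (D 2) := by
    rw [sg_cast_eq_sign sg hsg, hD2, ← im_arg_three x y, sign_mul_pos hNx]
  have c1 : (sg ((1 - x) / (1 - y)) : ℝ) = -Real.sign (D 1) := by
    rw [sg_cast_eq_sign sg hsg, hD1]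
    have e : (x.re - 1) * y.im - x.im * (y.re - 1) =
        -(((1 - x) / (1 - y)).im * Complex.normSq (1 - y)) := by
      rw [im_arg_five x y]; ring
    rw [e, sign_neg', sign_mul_pos hNy, neg_neg]
  have c0 : (sg ((1 - x⁻¹) / (1 - y⁻¹)) : ℝ) = -Real.sign (D 0) := by
    rw [sg_cast_eq_sign sg hsg, hD0]
    have e : x.re * y.im - x.im * y.re - Complex.normSq x * y.im + x.im * Complex.normSq y =
        ((1 - x⁻¹) / (1 - y⁻¹)).im * (Complex.normSq x * Complex.normSq (1 - y)) :=
      (im_arg_four hx0 hy0 hy1).symm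
    rw [e, sign_neg', sign_mul_pos (mul_pos hNx hNy), neg_neg]
  rw [I4, I3, I2, I1, I0, c4, c3, c2, c1, c0]
  -- both signs occur among the `λ_j = (-1)^j D j`, or everything vanishes
  by_cases hboth : (∃ j : Fin 5, 0 < (-1 : ℝ) ^ (j : ℕ) * D j) ∧ (∃ j : Fin 5, (-1 : ℝ) ^ (j : ℕ) * D j < 0)
  · have hgen : ∀ j a, D j ≠ 0 → D (j.succAbove a) ≠ 0 → E p j a ≠ 0 := by
      intro j a hj hja hE0
      exact hpN (mem_iUnion.mpr ⟨j, mem_iUnion.mpr ⟨a, hj, hja, hE0⟩⟩)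
    have key := stub_circuitCore v _ D (E p) (fun _ => rfl) (fun _ _ => rfl) hboth.1 hboth.2 hgen
    rw [Fin.sum_univ_five] at key
    have p0 : ((-1 : ℝ) ^ ((0 : Fin 5) : ℕ)) = 1 := by norm_num
    have p1 : ((-1 : ℝ) ^ ((1 : Fin 5) : ℕ)) = -1 := by norm_num
    have p2 : ((-1 : ℝ) ^ ((2 : Fin 5) : ℕ)) = 1 := by norm_num
    have p3 : ((-1 : ℝ) ^ ((3 : Fin 5) : ℕ)) = -1 := by norm_num
    have p4 : ((-1 : ℝ) ^ ((4 : Fin 5) : ℕ)) = 1 := by norm_num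
    rw [p0, p1, p2, p3, p4] at key
    linear_combination key
  · -- degenerate: all five minors vanish
    have hall : D 1 = 0 ∧ D 2 = 0 ∧ D 3 = 0 ∧ D 4 = 0 := by
      by_contra hne
      apply hboth
      have hex : ∀ t : ℝ, t ≠ 0 → 0 < t ∨ t < 0 := fun t ht => (lt_or_gt_of_ne ht).symm
      constructor
      · by_contra hnopos
        push Not at hnopos
        have a1 := hnopos 1; have a2 := hnopos 2; have a3 := hnopos 3; have a4 := hnopos 4
        simp only [Fin.val_one, Fin.val_two, pow_one] at a1 a2 a3 a4
        norm_num at a1 a2 a3 a4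
        apply hne
        refine ⟨by linarith, by linarith, by linarith, by linarith⟩
      · by_contra hnoneg
        push Not at hnoneg
        have a1 := hnoneg 1; have a2 := hnoneg 2; have a3 := hnoneg 3; have a4 := hnoneg 4
        simp only [Fin.val_one, Fin.val_two, pow_one] at a1 a2 a3 a4
        norm_num at a1 a2 a3 a4
        apply hne
        refine ⟨by linarith, by linarith, by linarith, by linarith⟩
    obtain ⟨e1, e2, e3, e4⟩ := hall
    have him_x : x.im = 0 := by rw [← hD4, e4]
    have him_y : y.im = 0 := by rw [← hD3, e3]
    have e0 : D 0 = 0 := by rw [hD0, him_x, him_y]; ring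
    rw [e0, e1, e2, e3, e4, Real.sign_zero]
    ring


end Summit.KontsevichZagierPeriods.HyperbolicBloch.FiveTerm

end
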